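import Summits.AtomisticToContinuum.Crystallization.Theorems.OverbindingBudgetRecurrentDust

/-!
# OverbindingBudget · generation 23 · node «PeriodicPricing» — part 1/3: statements, the one-law cone, locality and lattice algebra

Helper file for the crux `OverbindingBudget.RobustDefectLimitWindows` (RDEF, stmt-AtomisticToContinuum-31280) under the registered line v7
«HostedDustCut» (skeleton 624a0fa0…, UNTOUCHED: nothing registered, no stub re-typed).

## What this part states and proves

* `TypeFreeLaw D` — the TYPE-FREE defect charge law: a uniformly discrete texture of covering radius `< 9/10` that is thin-cored at an
  admissible spacing `a` (exactly clean Barlow sites within `D` of every point) and carries `L`-dense margin-`t` robust violators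
  (`¬ RT a t`, `0 < t ≤ 1/10`) has site charge `> η ℓ³` on arbitrarily large cubes.  It is the registered `DustLaw` (stub 5 of line v7) with
  the type hypotheses MAT / BurgersFree / Unsealed DELETED and the margin capped at `1/10` (`rt_mono` makes the cap free).
* **K-p1 `dustLaw_of_typeFreeLaw`**, **K-p2 `hostedTarget_of_typeFreeLaw`**, **K-p3 `rdef_of_typeFreeLaw_coherent`** (0 sorry): the minimal
  cone of record (generation 20, `rdef_of_laws_coherent`: laws 3, 4, 5 ∧ `CleanlessExcessT` ∧ `CoherentResidual 10`) needs only ONE law —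
  in the hosted world the crux supplies robust violators at EVERY admissible spacing, so the trichotomy dislocation / sealed / dust is not
  needed to reach `HostedTarget 10`.
* `PeriodicDefectPricing` (PDP) — the PERIODIC NORMAL FORM of the law (part 3 proves `TypeFreeLaw 10 ⟸ PDP`): for `ℓℤ³`-periodic,
  `δ`-separated textures of covering radius `< 5`, thin-cored within `D`, with `L`-dense margin-`t` robust violators, the site charge of one
  period cell is `≥ γ ℓ³` with `γ = γ(δ, a, t, D, L) > 0` UNIFORM in the texture and in the period `ℓ ≥ ℓ₁`.  No boundary term, finite-dimensional
  per period, and literally the quantity a periodic-supercell computation measures (census instrument I-RDU).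
* Locality of the site tests (`gt_congr_local`, `barlowClose_congr_local`, `rt_congr_local`: the status of a site depends on the texture only
  through the closed `2`-ball about it), lattice vectors `lvec`, `Periodic`, and covariance of the tests under the period lattice
  (`rt_shift`, `cleanT_shift`), coordinate / distance bookkeeping (`dist_le_two_mul_of_coord`, `dist_shift_gt`,
  `exists_reduce`, `exists_clamp`).

Deps (tree only): `…OverbindingBudgetRecurrentDust` (hence MinimalCone, CoherentCut, RecurrentSeal/DustStatements: `rt_mono`, `rt_translate`,
`cleanT_translate`, `mem_translate`), Literature `MuGSC`, `LennardJonesClusters`.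
-/

namespace Summit.AtomisticToContinuum.Crystallization.Theorems.OverbindingBudgetPeriodicPricingStatements

open scoped BigOperators Topology
open Literature.MathematicalPhysics.StatisticalMechanics (UniformlyDiscrete IsMuGSC lennardJones groundStateEnergy)
open Summit.AtomisticToContinuum.Crystallization.Theses.OverbindingBudget (RobustDefectLimitWindows CubeChargeLaw)
open Summit.AtomisticToContinuum.Crystallization.Theorems.OverbindingBudgetViolatorDensityFloor (GT RT)
open Summit.AtomisticToContinuum.Crystallization.Theorems.OverbindingBudgetWallTensionLever (BarlowClose MAT CleanT ThinCores)
open Summit.AtomisticToContinuum.Crystallization.Theorems.OverbindingBudgetCleanlessCut (Hosted HostedTarget)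
open Summit.AtomisticToContinuum.Crystallization.Theorems.OverbindingBudgetGradedBareness (CleanlessExcessT)
open Summit.AtomisticToContinuum.Crystallization.Theorems.OverbindingBudgetCoherentCut (CoherentResidual rdef_of_hosted_graded_coherent)
open Summit.AtomisticToContinuum.Crystallization.Theorems.OverbindingBudgetCubeChargeLaw (cubeChargeLaw)
open Summit.AtomisticToContinuum.Crystallization.Theorems.OverbindingBudgetMinimalCone (DustLaw)
open Summit.AtomisticToContinuum.Crystallization.Theorems.OverbindingBudgetRecurrentSealStatements (mem_translate cleanT_translate)
open Summit.AtomisticToContinuum.Crystallization.Theorems.OverbindingBudgetRecurrentDustStatements (rt_mono rt_translate cleanT_zero_iff)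

/-! ## §P  The statements -/

/-- **`TypeFreeLaw D`** — the type-free defect charge law (thin cores within `D`; margin `0 < t ≤ 1/10`).  At `D = 10` it implies the
registered `DustLaw` (K-p1) and closes the hosted world on its own (K-p2).  OPEN; part 3 reduces it to `PeriodicDefectPricing`. -/
def TypeFreeLaw (D : ℝ) : Prop :=
  ∀ e : ℝ, Filter.Tendsto (fun N : ℕ => groundStateEnergy lennardJones 3 N / N) Filter.atTop (nhds e) →
    (∀ N : ℕ, 0 < N → e ≤ groundStateEnergy lennardJones 3 N / N) →
    ∀ Y : Set (EuclideanSpace ℝ (Fin 3)), UniformlyDiscrete Y → (∀ z : EuclideanSpace ℝ (Fin 3), ∃ w ∈ Y, dist z w < 9 / 10) →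
    ∀ a : ℝ, 47 / 50 ≤ a → a ≤ 1 → ∀ t : ℝ, 0 < t → t ≤ 1 / 10 → ∀ L : ℝ, ThinCores a D Y →
    (∀ q ∈ Y, ∃ y ∈ Y, dist y q ≤ L ∧ ¬ RT a t Y y) →
    ∃ η : ℝ, 0 < η ∧ ∀ ℓ₀ : ℝ, ∃ ℓ : ℝ, ∃ c : EuclideanSpace ℝ (Fin 3), ∃ F : Finset (EuclideanSpace ℝ (Fin 3)),
      ℓ₀ ≤ ℓ ∧ (↑F : Set (EuclideanSpace ℝ (Fin 3))) = Y ∩ {z | ∀ i : Fin 3, c i ≤ z i ∧ z i < c i + ℓ} ∧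
      η * ℓ ^ 3 < ∑ y ∈ F, ((∑' w : ↥Y, lennardJones (dist y (w : EuclideanSpace ℝ (Fin 3)))) - 2 * e)

/-- **`PeriodicDefectPricing`** (PDP) — periodic defect pricing, the periodic normal form of the type-free law.  For the Lennard-Jones energy
`e` (the limit of `E_N/N`, a lower bound of every `E_N/N`), every separation `δ > 0`, admissible spacing `a`, margin `0 < t ≤ 1/10`, core
radius `D` and violator spacing `L` there are `γ > 0` and `ℓ₁` such that every `ℓℤ³`-PERIODIC (`ℓ ≥ ℓ₁`), `δ`-separated texture of covering
radius `< 5` that is thin-cored at spacing `a` within `D` and has `L`-dense margin-`t` robust violators carries site charge `≥ γ ℓ³` on every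
period cell `Y ∩ Q_ℓ(c)`.  (Equivalently `2·#(Y ∩ Q_ℓ(c))·(e_Y − e) ≥ γ ℓ³` with `e_Y` the energy per particle of the periodic configuration.)
OPEN · XL · instrumentable by periodic supercell minimisation. -/
def PeriodicDefectPricing : Prop :=
  ∀ e : ℝ, Filter.Tendsto (fun N : ℕ => groundStateEnergy lennardJones 3 N / N) Filter.atTop (nhds e) →
    (∀ N : ℕ, 0 < N → e ≤ groundStateEnergy lennardJones 3 N / N) →
    ∀ δ : ℝ, 0 < δ → ∀ a : ℝ, 47 / 50 ≤ a → a ≤ 1 → ∀ t : ℝ, 0 < t → t ≤ 1 / 10 → ∀ D L : ℝ,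
    ∃ γ : ℝ, 0 < γ ∧ ∃ ℓ₁ : ℝ, ∀ ℓ : ℝ, ℓ₁ ≤ ℓ → ∀ Y : Set (EuclideanSpace ℝ (Fin 3)),
      (∀ z ∈ Y, ∀ k : Fin 3 → ℤ, z + WithLp.toLp 2 (fun i => ℓ * (k i : ℝ)) ∈ Y) →
      (∀ x ∈ Y, ∀ y ∈ Y, x ≠ y → δ ≤ dist x y) →
      (∀ z : EuclideanSpace ℝ (Fin 3), ∃ w ∈ Y, dist z w < 5) →
      ThinCores a D Y →
      (∀ q ∈ Y, ∃ y ∈ Y, dist y q ≤ L ∧ ¬ RT a t Y y) →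
      ∀ c : EuclideanSpace ℝ (Fin 3), ∀ F : Finset (EuclideanSpace ℝ (Fin 3)),
        (↑F : Set (EuclideanSpace ℝ (Fin 3))) = Y ∩ {z | ∀ i : Fin 3, c i ≤ z i ∧ z i < c i + ℓ} →
        γ * ℓ ^ 3 ≤ ∑ y ∈ F, ((∑' w : ↥Y, lennardJones (dist y (w : EuclideanSpace ℝ (Fin 3)))) - 2 * e)

/-! ## §Q  The one-law cone (0 sorry): `TypeFreeLaw 10` replaces laws 3, 4, 5 of the minimal cone of record -/

/-- **K-p1.** The type-free law implies the registered `DustLaw` (stub 5 of line v7): delete the type hypotheses, cap the margin by `rt_mono`.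
[this file] -/
theorem dustLaw_of_typeFreeLaw (h : TypeFreeLaw 10) : DustLaw := by
  intro e hT hlb Y hUD hsolid a ha1 ha2 t ht L _hmat hthin _hBF _hUS hviol
  exact h e hT hlb Y hUD hsolid a ha1 ha2 (min t (1 / 10)) (lt_min ht (by norm_num)) (min_le_right _ _) L hthin
    (fun q hq => by
      obtain ⟨y, hy, hd, hn⟩ := hviol q hq
      exact ⟨y, hy, hd, fun hr => hn (rt_mono hUD (min_le_left _ _) hr)⟩)

/-- **K-p2.** The type-free law ALONE closes the hosted world `HostedTarget 10` (generation 14): in that world the crux supplies margin-`t`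
robust violators `L`-dense at EVERY admissible spacing, in particular at the hosting one, and the landed cube charge law contradicts the
charge.  No trichotomy (laws 3/4) is needed. [this file; uses `cubeChargeLaw` (stmt-30251)] -/
theorem hostedTarget_of_typeFreeLaw (h : TypeFreeLaw 10) : HostedTarget 10 := by
  have hcube := cubeChargeLaw
  unfold Summit.AtomisticToContinuum.Crystallization.Theses.OverbindingBudget.CubeChargeLaw at hcube
  unfold HostedTarget
  intro e hT hlb x hx Y h0 hrec hlim hUD hμ hgap hsolid haper hup hlow hacc htwo hthin hrob hh
  obtain ⟨a, ha1, ha2, _hmat, hthin'⟩ := hh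
  obtain ⟨L, t, ht, hr⟩ := hrob
  obtain ⟨η, hη, hbig⟩ := h e hT hlb Y hUD hsolid a ha1 ha2 (min t (1 / 10)) (lt_min ht (by norm_num)) (min_le_right _ _) L
    hthin'
    (fun q hq => by
      obtain ⟨y, hy, hd, hn⟩ := hr q hq a ha1 ha2
      exact ⟨y, hy, hd, fun hr' => hn (rt_mono hUD (min_le_left _ _) hr')⟩)
  obtain ⟨ℓ₀, hℓ₀⟩ := hcube e hlb Y hUD hμ η hη
  obtain ⟨ℓ, c, F, hℓ, hF, hlt⟩ := hbig ℓ₀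
  have habs := hℓ₀ ℓ c hℓ F hF
  exact absurd (lt_of_lt_of_le hlt (le_abs_self _)) (not_lt.mpr habs)

/-- **K-p3 (the one-law cone).** `TypeFreeLaw 10 ∧ CleanlessExcessT ∧ CoherentResidual 10 ⟹ RDEF` — compare the minimal cone of record
`rdef_of_laws_coherent` (three laws). [this file] -/
theorem rdef_of_typeFreeLaw_coherent (h : TypeFreeLaw 10) (hCE : CleanlessExcessT) (hR : CoherentResidual 10) :
    RobustDefectLimitWindows :=
  rdef_of_hosted_graded_coherent (hostedTarget_of_typeFreeLaw h) hCE hR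

/-- Monotonicity of the type-free law in the core radius: thinner cores are a stronger hypothesis. [this file] -/
theorem typeFreeLaw_mono {D D' : ℝ} (hDD : D ≤ D') (h : TypeFreeLaw D') : TypeFreeLaw D := by
  intro e hT hlb Y hUD hsolid a ha1 ha2 t ht ht1 L hthin hviol
  exact h e hT hlb Y hUD hsolid a ha1 ha2 t ht ht1 L (fun z => by
    obtain ⟨y, hy, hG, hB, hd⟩ := hthin z
    exact ⟨y, hy, hG, hB, hd.trans hDD⟩) hviol

/-! ## §R  Locality of the site tests: the status of `y` depends on the texture only through the closed `2`-ball about `y` -/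

/-- closed windows of radius `≤ 2` agree for textures agreeing on the `2`-ball -/
theorem window_congr_local {Y Y' : Set (EuclideanSpace ℝ (Fin 3))} {y : EuclideanSpace ℝ (Fin 3)} {r : ℝ} (hr : r ≤ 2)
    (hloc : ∀ w, dist y w ≤ 2 → (w ∈ Y ↔ w ∈ Y')) :
    {w ∈ Y | w ≠ y ∧ dist y w ≤ r} = {w ∈ Y' | w ≠ y ∧ dist y w ≤ r} := by
  ext w
  simp only [Set.mem_setOf_eq]
  constructor
  · rintro ⟨hw, hne, hd⟩; exact ⟨(hloc w (hd.trans hr)).1 hw, hne, hd⟩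
  · rintro ⟨hw, hne, hd⟩; exact ⟨(hloc w (hd.trans hr)).2 hw, hne, hd⟩

/-- open windows of radius `≤ 2` agree for textures agreeing on the `2`-ball -/
theorem window_congr_local_lt {Y Y' : Set (EuclideanSpace ℝ (Fin 3))} {y : EuclideanSpace ℝ (Fin 3)} {r : ℝ} (hr : r ≤ 2)
    (hloc : ∀ w, dist y w ≤ 2 → (w ∈ Y ↔ w ∈ Y')) :
    {w ∈ Y | w ≠ y ∧ dist y w < r} = {w ∈ Y' | w ≠ y ∧ dist y w < r} := by
  ext w
  simp only [Set.mem_setOf_eq]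
  constructor
  · rintro ⟨hw, hne, hd⟩; exact ⟨(hloc w (hd.le.trans hr)).1 hw, hne, hd⟩
  · rintro ⟨hw, hne, hd⟩; exact ⟨(hloc w (hd.le.trans hr)).2 hw, hne, hd⟩

/-- symmetry of local agreement -/
theorem local_symm {Y Y' : Set (EuclideanSpace ℝ (Fin 3))} {y : EuclideanSpace ℝ (Fin 3)}
    (hloc : ∀ w, dist y w ≤ 2 → (w ∈ Y ↔ w ∈ Y')) : ∀ w, dist y w ≤ 2 → (w ∈ Y' ↔ w ∈ Y) :=
  fun w hw => (hloc w hw).symm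

/-- **Locality of the exact gapped-twelve test.** [folklore; this file] -/
theorem gt_congr_local {a : ℝ} {Y Y' : Set (EuclideanSpace ℝ (Fin 3))} {y : EuclideanSpace ℝ (Fin 3)} (ha : a ≤ 1)
    (hloc : ∀ w, dist y w ≤ 2 → (w ∈ Y ↔ w ∈ Y')) (h : GT a Y y) : GT a Y' y := by
  obtain ⟨h1, h2⟩ := h
  refine ⟨?_, fun w hw hne => ?_⟩
  · rw [← window_congr_local (by linarith) hloc]; exact h1
  · by_cases hd : dist y w ≤ 2
    · exact h2 w ((hloc w hd).2 hw) hne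
    · rw [not_le] at hd
      exact ⟨by linarith, Or.inr (by linarith)⟩

/-- **Locality of `1/5`-Barlow-closeness.** [folklore; this file] -/
theorem barlowClose_congr_local {a : ℝ} {Y Y' : Set (EuclideanSpace ℝ (Fin 3))} {y : EuclideanSpace ℝ (Fin 3)} (ha : a ≤ 1)
    (hloc : ∀ w, dist y w ≤ 2 → (w ∈ Y ↔ w ∈ Y')) (h : BarlowClose a Y y) : BarlowClose a Y' y := by
  obtain ⟨T, hT, hP⟩ := h
  exact ⟨T, by rw [hT, window_congr_local (by linarith) hloc], hP⟩

/-- **Locality of the relaxed test** (margin `0 ≤ t ≤ 1/10`, so all windows have radius `≤ 2`). [folklore; this file] -/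
theorem rt_congr_local {a t : ℝ} {Y Y' : Set (EuclideanSpace ℝ (Fin 3))} {y : EuclideanSpace ℝ (Fin 3)} (ha : a ≤ 1)
    (ht0 : 0 ≤ t) (ht : t ≤ 1 / 10) (hloc : ∀ w, dist y w ≤ 2 → (w ∈ Y ↔ w ∈ Y')) (h : RT a t Y y) : RT a t Y' y := by
  obtain ⟨h1, h2, h3⟩ := h
  refine ⟨?_, ?_, fun w hw hne => ?_⟩
  · rw [← window_congr_local_lt (by linarith) hloc]; exact h1
  · rw [← window_congr_local (by linarith) hloc]; exact h2
  · by_cases hd : dist y w ≤ 2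
    · exact h3 w ((hloc w hd).2 hw) hne
    · rw [not_le] at hd
      exact ⟨by linarith, Or.inr (by linarith)⟩

/-! ## §S  Lattice vectors, periodic textures, covariance under the period lattice -/

/-- the lattice vector `ℓ·k`, `k ∈ ℤ³` -/
def lvec (ℓ : ℝ) (k : Fin 3 → ℤ) : EuclideanSpace ℝ (Fin 3) := WithLp.toLp 2 (fun i => ℓ * (k i : ℝ))

/-- coordinates of a lattice vector -/
@[simp] theorem lvec_apply (ℓ : ℝ) (k : Fin 3 → ℤ) (i : Fin 3) : lvec ℓ k i = ℓ * (k i : ℝ) := rfl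

/-- additivity -/
theorem lvec_add (ℓ : ℝ) (k k' : Fin 3 → ℤ) : lvec ℓ k + lvec ℓ k' = lvec ℓ (k + k') := by
  ext i; simp [lvec, mul_add]

/-- negation -/
theorem lvec_neg (ℓ : ℝ) (k : Fin 3 → ℤ) : lvec ℓ (-k) = -lvec ℓ k := by
  ext i; simp [lvec]

/-- zero -/
theorem lvec_zero (ℓ : ℝ) : lvec ℓ 0 = 0 := by
  ext i; simp [lvec]

/-- coordinates of a shifted point -/
theorem add_lvec_apply (y : EuclideanSpace ℝ (Fin 3)) (ℓ : ℝ) (k : Fin 3 → ℤ) (i : Fin 3) :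
    (y + lvec ℓ k) i = y i + ℓ * (k i : ℝ) := by
  simp [lvec]

/-- coordinates of a back-shifted point -/
theorem sub_lvec_apply (y : EuclideanSpace ℝ (Fin 3)) (ℓ : ℝ) (k : Fin 3 → ℤ) (i : Fin 3) :
    (y - lvec ℓ k) i = y i - ℓ * (k i : ℝ) := by
  simp [lvec]

/-- `Periodic ℓ Y`: the texture is invariant under the lattice `ℓℤ³` (verbatim the clause of `PeriodicDefectPricing`). -/
def Periodic (ℓ : ℝ) (Y : Set (EuclideanSpace ℝ (Fin 3))) : Prop :=
  ∀ z ∈ Y, ∀ k : Fin 3 → ℤ, z + lvec ℓ k ∈ Y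

/-- a periodic texture re-rooted at a lattice vector is itself -/
theorem translate_eq_of_periodic {ℓ : ℝ} {Y : Set (EuclideanSpace ℝ (Fin 3))} (hY : Periodic ℓ Y) (k : Fin 3 → ℤ) :
    (fun p => p - lvec ℓ k) '' Y = Y := by
  ext w
  rw [mem_translate]
  constructor
  · intro h
    have := hY _ h (-k)
    rwa [lvec_neg, add_neg_cancel_right] at this
  · intro h; exact hY w h k

/-- **Covariance of the relaxed test under the period lattice.** [folklore; from `rt_translate`] -/
theorem rt_shift {ℓ a s : ℝ} {Y : Set (EuclideanSpace ℝ (Fin 3))} (hY : Periodic ℓ Y) (k : Fin 3 → ℤ)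
    {y : EuclideanSpace ℝ (Fin 3)} (h : RT a s Y y) : RT a s Y (y + lvec ℓ k) := by
  have h1 := rt_translate (lvec ℓ (-k)) h
  rwa [translate_eq_of_periodic hY (-k), lvec_neg, sub_neg_eq_add] at h1

/-- the converse shift -/
theorem rt_unshift {ℓ a s : ℝ} {Y : Set (EuclideanSpace ℝ (Fin 3))} (hY : Periodic ℓ Y) (k : Fin 3 → ℤ)
    {y : EuclideanSpace ℝ (Fin 3)} (h : RT a s Y (y + lvec ℓ k)) : RT a s Y y := by
  have h1 := rt_shift hY (-k) h
  rwa [lvec_neg, add_neg_cancel_right] at h1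

/-- **Covariance of robust / exact cleanness under the period lattice.** [folklore; from `cleanT_translate`] -/
theorem cleanT_shift {ℓ a s : ℝ} {Y : Set (EuclideanSpace ℝ (Fin 3))} (hY : Periodic ℓ Y) (k : Fin 3 → ℤ)
    {y : EuclideanSpace ℝ (Fin 3)} (h : CleanT a s Y y) : CleanT a s Y (y + lvec ℓ k) := by
  have h1 := cleanT_translate (lvec ℓ (-k)) h
  rwa [translate_eq_of_periodic hY (-k), lvec_neg, sub_neg_eq_add] at h1

/-- exact clean Barlow-close sites shift -/
theorem gt_barlow_shift {ℓ a : ℝ} {Y : Set (EuclideanSpace ℝ (Fin 3))} (hY : Periodic ℓ Y) (k : Fin 3 → ℤ)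
    {y : EuclideanSpace ℝ (Fin 3)} (hG : GT a Y y) (hB : BarlowClose a Y y) :
    GT a Y (y + lvec ℓ k) ∧ BarlowClose a Y (y + lvec ℓ k) :=
  cleanT_zero_iff.1 (cleanT_shift hY k (cleanT_zero_iff.2 ⟨hG, hB⟩))

/-! ## §T  Coordinates and distances -/

/-- coordinates move by at most the distance (two-sided form; the one-sided `|x i - y i| ≤ dist x y` is
`PeriodicWindowsSketch.gl_coord_sub_le_dist` = `PiLp.dist_apply_le`) -/
theorem coord_le_of_dist_le {x y : EuclideanSpace ℝ (Fin 3)} {r : ℝ} (h : dist x y ≤ r) (i : Fin 3) :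
    x i - y i ≤ r ∧ y i - x i ≤ r := by
  have h1 : |x i - y i| ≤ dist x y := by rw [← Real.dist_eq]; exact PiLp.dist_apply_le x y i
  rw [abs_le] at h1
  constructor <;> linarith

/-- the distance is at most twice the largest coordinate difference (`2 ≥ √3`) -/
theorem dist_le_two_mul_of_coord {x y : EuclideanSpace ℝ (Fin 3)} {m : ℝ} (hm : 0 ≤ m) (h : ∀ i, |x i - y i| ≤ m) :
    dist x y ≤ 2 * m := by
  rw [EuclideanSpace.dist_eq]
  have hi : ∀ i, dist (x i) (y i) ^ 2 ≤ m ^ 2 := fun i => by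
    rw [Real.dist_eq]
    have := h i
    nlinarith [abs_nonneg (x i - y i)]
  calc √(∑ i, dist (x i) (y i) ^ 2) ≤ √(∑ _i : Fin 3, m ^ 2) := Real.sqrt_le_sqrt (Finset.sum_le_sum fun i _ => hi i)
    _ = √(3 * m ^ 2) := by simp
    _ ≤ √((2 * m) ^ 2) := Real.sqrt_le_sqrt (by nlinarith)
    _ = 2 * m := Real.sqrt_sq (by linarith)

/-- **Copies are far.** If all coordinate differences of `y, y'` are `< ℓ − m` and `k ≠ 0`, then `y` is at distance `> m` from the
`k`-th copy of `y'`. [this file] -/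
theorem dist_shift_gt {ℓ m : ℝ} (hℓ : 0 ≤ ℓ) {y y' : EuclideanSpace ℝ (Fin 3)} (h : ∀ i, |y i - y' i| < ℓ - m)
    {k : Fin 3 → ℤ} (hk : k ≠ 0) : m < dist y (y' + lvec ℓ k) := by
  obtain ⟨i, hi⟩ : ∃ i, k i ≠ 0 := Function.ne_iff.mp hk
  have h1 : (1 : ℝ) ≤ |(k i : ℝ)| := by
    rw [← Int.cast_abs]; exact_mod_cast Int.one_le_abs hi
  have hcoord : |y i - (y' + lvec ℓ k) i| ≤ dist y (y' + lvec ℓ k) := by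
    rw [← Real.dist_eq]; exact PiLp.dist_apply_le _ _ i
  rw [add_lvec_apply] at hcoord
  have h2 : |y' i + ℓ * (k i : ℝ) - y' i| ≤ |y' i + ℓ * (k i : ℝ) - y i| + |y i - y' i| := abs_sub_le _ _ _
  have h3 : |y' i + ℓ * (k i : ℝ) - y' i| = ℓ * |(k i : ℝ)| := by
    rw [show y' i + ℓ * (k i : ℝ) - y' i = ℓ * (k i : ℝ) by ring, abs_mul, abs_of_nonneg hℓ]
  have h4 : ℓ * 1 ≤ ℓ * |(k i : ℝ)| := mul_le_mul_of_nonneg_left h1 hℓ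
  have h5 := h i
  rw [abs_sub_comm (y' i + ℓ * (k i : ℝ)) (y i)] at h2
  linarith

/-- **Reduction modulo the period.** Every point is a lattice translate of a point of the period cell `Q_ℓ(c)`. [this file] -/
theorem exists_reduce {ℓ : ℝ} (hℓ : 0 < ℓ) (c p : EuclideanSpace ℝ (Fin 3)) :
    ∃ k : Fin 3 → ℤ, ∀ i : Fin 3, c i ≤ (p - lvec ℓ k) i ∧ (p - lvec ℓ k) i < c i + ℓ := by
  refine ⟨fun i => ⌊(p i - c i) / ℓ⌋, fun i => ?_⟩
  rw [sub_lvec_apply]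
  have h1 := Int.floor_le ((p i - c i) / ℓ)
  have h2 := Int.lt_floor_add_one ((p i - c i) / ℓ)
  have e : ℓ * ((p i - c i) / ℓ) = p i - c i := by field_simp
  constructor
  · have := mul_le_mul_of_nonneg_left h1 hℓ.le
    rw [e] at this; linarith
  · have := mul_lt_mul_of_pos_left h2 hℓ
    rw [mul_add, e, mul_one] at this; linarith

/-- **Clamping into the interior of the cell.** A point of `Q_ℓ(c)` is within `2·max(lo, hi)` of a point whose coordinates lie in
`[c_i + lo, c_i + ℓ − hi]`. [this file] -/
theorem exists_clamp {ℓ lo hi : ℝ} (hlo : 0 ≤ lo) (hℓ : lo + hi ≤ ℓ) (c q : EuclideanSpace ℝ (Fin 3))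
    (hq : ∀ i : Fin 3, c i ≤ q i ∧ q i < c i + ℓ) :
    ∃ q' : EuclideanSpace ℝ (Fin 3), (∀ i : Fin 3, c i + lo ≤ q' i ∧ q' i ≤ c i + ℓ - hi) ∧ dist q q' ≤ 2 * max lo hi := by
  refine ⟨WithLp.toLp 2 (fun i => max (c i + lo) (min (q i) (c i + ℓ - hi))), fun i => ?_, ?_⟩
  · change c i + lo ≤ max (c i + lo) (min (q i) (c i + ℓ - hi)) ∧ max (c i + lo) (min (q i) (c i + ℓ - hi)) ≤ c i + ℓ - hi
    exact ⟨le_max_left _ _, max_le (by linarith) (min_le_right _ _)⟩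
  · refine dist_le_two_mul_of_coord (hlo.trans (le_max_left _ _)) fun i => ?_
    change |q i - max (c i + lo) (min (q i) (c i + ℓ - hi))| ≤ max lo hi
    rcases le_or_gt (q i) (c i + ℓ - hi) with h1 | h1
    · rw [min_eq_left h1]
      rcases le_or_gt (c i + lo) (q i) with h2 | h2
      · rw [max_eq_right h2, sub_self, abs_zero]; exact hlo.trans (le_max_left _ _)
      · rw [max_eq_left h2.le, abs_of_nonpos (by linarith)]
        exact le_trans (by linarith [(hq i).1]) (le_max_left _ _)
    · rw [min_eq_right h1.le]
      have h3 : c i + lo ≤ c i + ℓ - hi := by linarith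
      rw [max_eq_right h3, abs_of_nonneg (by linarith)]
      exact le_trans (by linarith [(hq i).2]) (le_max_right _ _)

end Summit.AtomisticToContinuum.Crystallization.Theorems.OverbindingBudgetPeriodicPricingStatements
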